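import Mathlib
import HarnessLib
import Literature.Analysis.FluidPDE.SelfSimilar
import Literature.Analysis.FluidPDE.LocalTypeI
import Literature.Analysis.FluidPDE.VectorCalculus
import Literature.Analysis.FluidPDE.CurlFreeLiouville
import Literature.Analysis.FluidPDE.TypeIAncientMild
import Summits.NavierStokesRegularity.NavierStokesRegularity.Theorems.PoloidalWindowDoorPoloidalWindowRigidityWindow
import Summits.NavierStokesRegularity.NavierStokesRegularity.Theorems.PoloidalWindowDoorPoloidalWindowRigidityFlat
import Summits.NavierStokesRegularity.NavierStokesRegularity.Theorems.LocalSineTubeDoorProfileAlignedWindowRigidityAncient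

/-!
# Route `PoloidalWindowDoor`, crux `PoloidalWindowRigidity` (K2, stmt-NavierStokesRegularity-19708) —
# the PROPORTIONAL-SHEAR stratum (constant Clebsch slope `λ ∉ [0,1]`) of the residue is EMPTY

Cell ns-regularity-ideate, seat ns-poloidal-K2-p1 (support file for the K2 line `slicesharp-screw`,
`--supports stmt-…-19708 --as helper`).

For a poloidal field (`ω₂ ≡ 0`, `ω = curl v`) with Clebsch stream function `ψ` (`∇_h ψ = (−ω₁, ω₀)`) the
frozen constraint makes `v₂` a function of `ψ` on every horizontal leaf; its slope `Λ = ∂v₂/∂ψ` (`= H_ψψ` for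
the head `H`, scaling weight 0, constant on vortex lines) is CONSTANT, `Λ ≡ λ`, exactly on the stratum
`∂₂ v_h ≡ μ ∇_h v₂` with `μ = 1 − 1/λ` (kinematics: `∂₂v_h = −∇_hψ + ∇_hv₂`).  Both explicit rotational
poloidal Navier–Stokes families known to the cell lie on it (nsreg-p1's `U♭`: `λ = 2`, `μ = ½`; nsreg-p7's tilted
quadratic family CENSUS-K2G §13: `λ = 2/3`, `μ = −½`; kit j257675), while the Landau solutions do not.

**This file empties the half `μ > 0` (`λ > 1` or `λ < 0`) inside the route's Type-I class**, by an elementary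
global argument: if `∂₂v₀ = μ ∂₀v₂`, `∂₂v₁ = μ ∂₁v₂` and `∂₀v₁ = ∂₁v₀` on a slice, the anisotropically rescaled field
`ũ(y) = M v(N y)`, `M = diag(1,1,√μ)`, `N = diag(1,1,1/√μ) = M⁻¹`, is CURL-FREE (its Jacobian `M·Dv·N` is symmetric)
and DIVERGENCE-FREE (`tr(M·Dv·N) = tr Dv = 0`) and bounded, hence constant (tree div–curl Liouville
`eq_of_curl_eq_zero_of_isDivFree_of_bounded`); so the slice is constant and the profile vanishes by the Type-I rate
(`IsTypeIAncientMild.eq_zero_of_slice_const`).  Equivalently (`(v₀, v₁, μ v₂) = ∇Φ` with `Δ_hΦ + μ⁻¹∂₂²Φ = 0`):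
a bounded-gradient entire solution of an ELLIPTIC constant-coefficient equation is affine.  The half `μ < 0`
(`0 < λ < 1`) is hyperbolic (`x₂` time-like) and is NOT settled here.

* `rescale_apply_*`                      — the diagonal maps `D c = id + (c−1)·e₂⊗e₂*` in coordinates;
* `curl_rescale_eq_zero`, `isDivFree_rescale` — the rescaled slice is curl- and divergence-free;
* `eq_zero_of_proportionalShear`        — the stratum `μ > 0` is empty in the class (`v ≡ 0`);
* `eq_zero_of_clebschSlope_const`        — the same from `∇_h v₂ = λ(−ω₁, ω₀)` with `λ ∉ [0,1]`;
* `nonflatLiouville_of_proportionalShear` — in the «not backward-singular» currency of the stub.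

WHAT THIS IS NOT: not a claim about Navier–Stokes regularity and not the open residue S2′ — one more settled
stratum (bears_on LADDER-NS N0, rung N0-LocalTubeDoorPoloidal).
-/

noncomputable section

-- the summit and its single sub-problem share the name (CONVENTIONS §1), as in every Theorems file
set_option linter.dupNamespace false

namespace Summit.NavierStokesRegularity.NavierStokesRegularity.Theorems.PoloidalWindowDoorPoloidalWindowRigidityProportionalShear

open Set Function Filter Topology
open scoped RealInnerProductSpace InnerProductSpace
open Literature.Analysis Literature.Analysis.FluidPDE
open Summit.NavierStokesRegularity.NavierStokesRegularity.Theorems.LocalSineTubeDoorProfileAlignedWindowRigidityAncient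
open Summit.NavierStokesRegularity.NavierStokesRegularity.Theorems.PoloidalWindowDoorPoloidalWindowRigidityWindow
open Summit.NavierStokesRegularity.NavierStokesRegularity.Theorems.PoloidalWindowDoorPoloidalWindowRigidityFlat

/-! ### The diagonal rescaling `D c : (y₀, y₁, y₂) ↦ (y₀, y₁, c y₂)` as a continuous linear map -/

/-- Coordinates of `D c y = y + (c − 1) y₂ e₂`: components `0`, `1` are unchanged. -/
theorem rescale_apply_zero (c : ℝ) (y : EuclideanSpace ℝ (Fin 3)) :
    ((ContinuousLinearMap.id ℝ (EuclideanSpace ℝ (Fin 3)) +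
        (c - 1) • (EuclideanSpace.proj (2 : Fin 3) : EuclideanSpace ℝ (Fin 3) →L[ℝ] ℝ).smulRight
          (EuclideanSpace.single (2 : Fin 3) (1 : ℝ))) y) 0 = y 0 := by
  simp

/-- Coordinates of `D c y`: component `1`. -/
theorem rescale_apply_one (c : ℝ) (y : EuclideanSpace ℝ (Fin 3)) :
    ((ContinuousLinearMap.id ℝ (EuclideanSpace ℝ (Fin 3)) +
        (c - 1) • (EuclideanSpace.proj (2 : Fin 3) : EuclideanSpace ℝ (Fin 3) →L[ℝ] ℝ).smulRight
          (EuclideanSpace.single (2 : Fin 3) (1 : ℝ))) y) 1 = y 1 := by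
  simp

/-- Coordinates of `D c y`: component `2` is `c y₂`. -/
theorem rescale_apply_two (c : ℝ) (y : EuclideanSpace ℝ (Fin 3)) :
    ((ContinuousLinearMap.id ℝ (EuclideanSpace ℝ (Fin 3)) +
        (c - 1) • (EuclideanSpace.proj (2 : Fin 3) : EuclideanSpace ℝ (Fin 3) →L[ℝ] ℝ).smulRight
          (EuclideanSpace.single (2 : Fin 3) (1 : ℝ))) y) 2 = c * y 2 := by
  simp; ring


/-- `D c⁻¹ (D c y) = y` for `c ≠ 0`: the two rescalings are inverse to each other. -/
theorem rescale_inv_apply {c : ℝ} (hc : c ≠ 0) (y : EuclideanSpace ℝ (Fin 3)) :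
    (ContinuousLinearMap.id ℝ (EuclideanSpace ℝ (Fin 3)) +
        (c⁻¹ - 1) • (EuclideanSpace.proj (2 : Fin 3) : EuclideanSpace ℝ (Fin 3) →L[ℝ] ℝ).smulRight
          (EuclideanSpace.single (2 : Fin 3) (1 : ℝ)))
      ((ContinuousLinearMap.id ℝ (EuclideanSpace ℝ (Fin 3)) +
        (c - 1) • (EuclideanSpace.proj (2 : Fin 3) : EuclideanSpace ℝ (Fin 3) →L[ℝ] ℝ).smulRight
          (EuclideanSpace.single (2 : Fin 3) (1 : ℝ))) y) = y := by
  ext i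
  fin_cases i
  · simp
  · simp
  · simp; field_simp; ring

/-- **The rescaled slice is curl-free.** Let `V` be differentiable at `N y` (`N = D c⁻¹`), with
`∂₀V₁ = ∂₁V₀` (poloidal), `∂₂V₀ = μ ∂₀V₂`, `∂₂V₁ = μ ∂₁V₂` there, `μ = c²`, `c ≠ 0`.  Then the field
`ũ = D c ∘ V ∘ D c⁻¹` has `curl ũ (y) = 0`. -/
theorem curl_rescale_eq_zero {V : EuclideanSpace ℝ (Fin 3) → EuclideanSpace ℝ (Fin 3)} {c μ : ℝ} (hc : c ≠ 0)
    (hμ : μ = c ^ 2) (y : EuclideanSpace ℝ (Fin 3))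
    (hd : DifferentiableAt ℝ V
      ((ContinuousLinearMap.id ℝ (EuclideanSpace ℝ (Fin 3)) +
        (c⁻¹ - 1) • (EuclideanSpace.proj (2 : Fin 3) : EuclideanSpace ℝ (Fin 3) →L[ℝ] ℝ).smulRight
          (EuclideanSpace.single (2 : Fin 3) (1 : ℝ))) y))
    (hpol : fderiv ℝ V ((ContinuousLinearMap.id ℝ (EuclideanSpace ℝ (Fin 3)) +
        (c⁻¹ - 1) • (EuclideanSpace.proj (2 : Fin 3) : EuclideanSpace ℝ (Fin 3) →L[ℝ] ℝ).smulRight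
          (EuclideanSpace.single (2 : Fin 3) (1 : ℝ))) y) (EuclideanSpace.single 0 (1 : ℝ)) 1 =
      fderiv ℝ V ((ContinuousLinearMap.id ℝ (EuclideanSpace ℝ (Fin 3)) +
        (c⁻¹ - 1) • (EuclideanSpace.proj (2 : Fin 3) : EuclideanSpace ℝ (Fin 3) →L[ℝ] ℝ).smulRight
          (EuclideanSpace.single (2 : Fin 3) (1 : ℝ))) y) (EuclideanSpace.single 1 (1 : ℝ)) 0)
    (h0 : fderiv ℝ V ((ContinuousLinearMap.id ℝ (EuclideanSpace ℝ (Fin 3)) +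
        (c⁻¹ - 1) • (EuclideanSpace.proj (2 : Fin 3) : EuclideanSpace ℝ (Fin 3) →L[ℝ] ℝ).smulRight
          (EuclideanSpace.single (2 : Fin 3) (1 : ℝ))) y) (EuclideanSpace.single 2 (1 : ℝ)) 0 =
      μ * fderiv ℝ V ((ContinuousLinearMap.id ℝ (EuclideanSpace ℝ (Fin 3)) +
        (c⁻¹ - 1) • (EuclideanSpace.proj (2 : Fin 3) : EuclideanSpace ℝ (Fin 3) →L[ℝ] ℝ).smulRight
          (EuclideanSpace.single (2 : Fin 3) (1 : ℝ))) y) (EuclideanSpace.single 0 (1 : ℝ)) 2)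
    (h1 : fderiv ℝ V ((ContinuousLinearMap.id ℝ (EuclideanSpace ℝ (Fin 3)) +
        (c⁻¹ - 1) • (EuclideanSpace.proj (2 : Fin 3) : EuclideanSpace ℝ (Fin 3) →L[ℝ] ℝ).smulRight
          (EuclideanSpace.single (2 : Fin 3) (1 : ℝ))) y) (EuclideanSpace.single 2 (1 : ℝ)) 1 =
      μ * fderiv ℝ V ((ContinuousLinearMap.id ℝ (EuclideanSpace ℝ (Fin 3)) +
        (c⁻¹ - 1) • (EuclideanSpace.proj (2 : Fin 3) : EuclideanSpace ℝ (Fin 3) →L[ℝ] ℝ).smulRight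
          (EuclideanSpace.single (2 : Fin 3) (1 : ℝ))) y) (EuclideanSpace.single 1 (1 : ℝ)) 2) :
    curl (fun y : EuclideanSpace ℝ (Fin 3) =>
      (ContinuousLinearMap.id ℝ (EuclideanSpace ℝ (Fin 3)) +
        (c - 1) • (EuclideanSpace.proj (2 : Fin 3) : EuclideanSpace ℝ (Fin 3) →L[ℝ] ℝ).smulRight
          (EuclideanSpace.single (2 : Fin 3) (1 : ℝ)))
        (V ((ContinuousLinearMap.id ℝ (EuclideanSpace ℝ (Fin 3)) +
          (c⁻¹ - 1) • (EuclideanSpace.proj (2 : Fin 3) : EuclideanSpace ℝ (Fin 3) →L[ℝ] ℝ).smulRight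
            (EuclideanSpace.single (2 : Fin 3) (1 : ℝ))) y))) y = 0 := by
  set M : EuclideanSpace ℝ (Fin 3) →L[ℝ] EuclideanSpace ℝ (Fin 3) :=
    ContinuousLinearMap.id ℝ (EuclideanSpace ℝ (Fin 3)) +
      (c - 1) • (EuclideanSpace.proj (2 : Fin 3) : EuclideanSpace ℝ (Fin 3) →L[ℝ] ℝ).smulRight
        (EuclideanSpace.single (2 : Fin 3) (1 : ℝ)) with hM
  set N : EuclideanSpace ℝ (Fin 3) →L[ℝ] EuclideanSpace ℝ (Fin 3) :=
    ContinuousLinearMap.id ℝ (EuclideanSpace ℝ (Fin 3)) +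
      (c⁻¹ - 1) • (EuclideanSpace.proj (2 : Fin 3) : EuclideanSpace ℝ (Fin 3) →L[ℝ] ℝ).smulRight
        (EuclideanSpace.single (2 : Fin 3) (1 : ℝ)) with hN
  have hF : HasFDerivAt (fun y : EuclideanSpace ℝ (Fin 3) => M (V (N y)))
      (M.comp ((fderiv ℝ V (N y)).comp N)) y :=
    M.hasFDerivAt.comp y (hd.hasFDerivAt.comp y N.hasFDerivAt)
  set A := fderiv ℝ V (N y) with hA
  have hN0 : N (EuclideanSpace.single 0 (1 : ℝ)) = EuclideanSpace.single 0 (1 : ℝ) := by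
    ext i; fin_cases i <;> simp [hN]
  have hN1 : N (EuclideanSpace.single 1 (1 : ℝ)) = EuclideanSpace.single 1 (1 : ℝ) := by
    ext i; fin_cases i <;> simp [hN]
  have hN2 : N (EuclideanSpace.single 2 (1 : ℝ)) = c⁻¹ • EuclideanSpace.single 2 (1 : ℝ) := by
    ext i; fin_cases i <;> simp [hN]
  have hM0 : ∀ w, (M w) 0 = w 0 := fun w => rescale_apply_zero c w
  have hM1 : ∀ w, (M w) 1 = w 1 := fun w => rescale_apply_one c w
  have hM2 : ∀ w, (M w) 2 = c * w 2 := fun w => rescale_apply_two c w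
  have hc2 : c⁻¹ * μ = c := by rw [hμ]; field_simp
  ext i
  fin_cases i
  · -- component 0: D 1 2 − D 2 1 = c ∂₁V₂ − c⁻¹ ∂₂V₁ = 0
    simp only [curl, hF.fderiv, ContinuousLinearMap.comp_apply, hN0, hN1, hN2, map_smul, PiLp.smul_apply,
      smul_eq_mul, hM0, hM1, hM2]
    simp
    rw [h1]
    linear_combination (-(fderiv ℝ V (N y) (EuclideanSpace.single 1 1) 2)) * hc2
  · simp only [curl, hF.fderiv, ContinuousLinearMap.comp_apply, hN0, hN1, hN2, map_smul, PiLp.smul_apply,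
      smul_eq_mul, hM0, hM1, hM2]
    simp
    rw [h0]
    linear_combination (fderiv ℝ V (N y) (EuclideanSpace.single 0 1) 2) * hc2
  · simp only [curl, hF.fderiv, ContinuousLinearMap.comp_apply, hN0, hN1, hN2, map_smul, PiLp.smul_apply,
      smul_eq_mul, hM0, hM1, hM2]
    simp
    rw [hpol]; ring


/-- **The rescaled slice is divergence-free**: `tr(M·DV·N) = tr(DV·N·M) = tr DV = 0` since `N = M⁻¹`. -/
theorem divergence_rescale_eq_zero {V : EuclideanSpace ℝ (Fin 3) → EuclideanSpace ℝ (Fin 3)} {c : ℝ} (hc : c ≠ 0)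
    (y : EuclideanSpace ℝ (Fin 3))
    (hd : DifferentiableAt ℝ V
      ((ContinuousLinearMap.id ℝ (EuclideanSpace ℝ (Fin 3)) +
        (c⁻¹ - 1) • (EuclideanSpace.proj (2 : Fin 3) : EuclideanSpace ℝ (Fin 3) →L[ℝ] ℝ).smulRight
          (EuclideanSpace.single (2 : Fin 3) (1 : ℝ))) y))
    (hdiv : VectorCalculus.divergence V ((ContinuousLinearMap.id ℝ (EuclideanSpace ℝ (Fin 3)) +
        (c⁻¹ - 1) • (EuclideanSpace.proj (2 : Fin 3) : EuclideanSpace ℝ (Fin 3) →L[ℝ] ℝ).smulRight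
          (EuclideanSpace.single (2 : Fin 3) (1 : ℝ))) y) = 0) :
    VectorCalculus.divergence (fun y : EuclideanSpace ℝ (Fin 3) =>
      (ContinuousLinearMap.id ℝ (EuclideanSpace ℝ (Fin 3)) +
        (c - 1) • (EuclideanSpace.proj (2 : Fin 3) : EuclideanSpace ℝ (Fin 3) →L[ℝ] ℝ).smulRight
          (EuclideanSpace.single (2 : Fin 3) (1 : ℝ)))
        (V ((ContinuousLinearMap.id ℝ (EuclideanSpace ℝ (Fin 3)) +
          (c⁻¹ - 1) • (EuclideanSpace.proj (2 : Fin 3) : EuclideanSpace ℝ (Fin 3) →L[ℝ] ℝ).smulRight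
            (EuclideanSpace.single (2 : Fin 3) (1 : ℝ))) y))) y = 0 := by
  set M : EuclideanSpace ℝ (Fin 3) →L[ℝ] EuclideanSpace ℝ (Fin 3) :=
    ContinuousLinearMap.id ℝ (EuclideanSpace ℝ (Fin 3)) +
      (c - 1) • (EuclideanSpace.proj (2 : Fin 3) : EuclideanSpace ℝ (Fin 3) →L[ℝ] ℝ).smulRight
        (EuclideanSpace.single (2 : Fin 3) (1 : ℝ)) with hM
  set N : EuclideanSpace ℝ (Fin 3) →L[ℝ] EuclideanSpace ℝ (Fin 3) :=
    ContinuousLinearMap.id ℝ (EuclideanSpace ℝ (Fin 3)) +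
      (c⁻¹ - 1) • (EuclideanSpace.proj (2 : Fin 3) : EuclideanSpace ℝ (Fin 3) →L[ℝ] ℝ).smulRight
        (EuclideanSpace.single (2 : Fin 3) (1 : ℝ)) with hN
  have hF : HasFDerivAt (fun y : EuclideanSpace ℝ (Fin 3) => M (V (N y)))
      (M.comp ((fderiv ℝ V (N y)).comp N)) y :=
    M.hasFDerivAt.comp y (hd.hasFDerivAt.comp y N.hasFDerivAt)
  have hNM : (N : EuclideanSpace ℝ (Fin 3) →ₗ[ℝ] EuclideanSpace ℝ (Fin 3)).comp
      (M : EuclideanSpace ℝ (Fin 3) →ₗ[ℝ] EuclideanSpace ℝ (Fin 3)) = LinearMap.id := by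
    apply LinearMap.ext
    intro w
    simpa [hM, hN] using rescale_inv_apply hc w
  unfold VectorCalculus.divergence
  rw [hF.fderiv,
    show ((M.comp ((fderiv ℝ V (N y)).comp N) : EuclideanSpace ℝ (Fin 3) →L[ℝ] EuclideanSpace ℝ (Fin 3)) :
        EuclideanSpace ℝ (Fin 3) →ₗ[ℝ] EuclideanSpace ℝ (Fin 3)) =
      (M : EuclideanSpace ℝ (Fin 3) →ₗ[ℝ] EuclideanSpace ℝ (Fin 3)).comp
        (((fderiv ℝ V (N y) : EuclideanSpace ℝ (Fin 3) →L[ℝ] EuclideanSpace ℝ (Fin 3)) :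
            EuclideanSpace ℝ (Fin 3) →ₗ[ℝ] EuclideanSpace ℝ (Fin 3)).comp
          (N : EuclideanSpace ℝ (Fin 3) →ₗ[ℝ] EuclideanSpace ℝ (Fin 3))) from rfl,
    LinearMap.trace_comp_comm', LinearMap.comp_assoc, hNM, LinearMap.comp_id]
  exact hdiv

/-- Component `2` of the vorticity: `(curl V)₂ = ∂₀V₁ − ∂₁V₀`. -/
theorem curl_apply_two_eq (V : EuclideanSpace ℝ (Fin 3) → EuclideanSpace ℝ (Fin 3)) (x : EuclideanSpace ℝ (Fin 3)) :
    curl V x 2 = fderiv ℝ V x (EuclideanSpace.single 0 (1 : ℝ)) 1 - fderiv ℝ V x (EuclideanSpace.single 1 (1 : ℝ)) 0 := by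
  simp [curl]

/-- **THE PROPORTIONAL-SHEAR STRATUM (`μ > 0`) IS EMPTY.**  A profile `v` of the route's Type-I class (rate,
continuity on the open slab, unit-viscosity Oseen-mild identity, divergence-free slices), poloidal along `e₂`, whose
vertical shear of the horizontal velocity is a POSITIVE constant multiple of the horizontal gradient of the vertical
velocity on every slice, `∂₂v₀ = μ ∂₀v₂`, `∂₂v₁ = μ ∂₁v₂`, `μ > 0` (equivalently: constant Clebsch slope
`∂v₂/∂ψ = 1/(1−μ) ∉ [0,1]`), vanishes identically. -/
theorem eq_zero_of_proportionalShear {C : ℝ} {v : ℝ → EuclideanSpace ℝ (Fin 3) → EuclideanSpace ℝ (Fin 3)}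
    (hrate : HasTypeITimeDecay C v)
    (hcont : ContinuousOn (uncurry v) (Iio (0 : ℝ) ×ˢ univ))
    (hmild : ∀ s t : ℝ, s < t → t < 0 → ∀ x,
      v t x = UnboundedOperators.heatExtension (v s) (t - s) x - oseenDuhamel 1 s v v t x)
    (hdiv : ∀ t < 0, VectorCalculus.IsDivFree (v t))
    (hpol : ∀ s < 0, ∀ y, ⟪curl (v s) y, EuclideanSpace.single 2 1⟫_ℝ = 0)
    {μ : ℝ} (hμ : 0 < μ)
    (hshear : ∀ s < 0, ∀ y, fderiv ℝ (v s) y (EuclideanSpace.single 2 (1 : ℝ)) 0 =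
        μ * fderiv ℝ (v s) y (EuclideanSpace.single 0 (1 : ℝ)) 2 ∧
      fderiv ℝ (v s) y (EuclideanSpace.single 2 (1 : ℝ)) 1 =
        μ * fderiv ℝ (v s) y (EuclideanSpace.single 1 (1 : ℝ)) 2) :
    ∀ t < 0, ∀ x, v t x = 0 := by
  have hA : IsTypeIAncientMild C v := isTypeIAncientMild_of_class hrate hcont hmild hdiv
  -- the rescalings `M = D c`, `N = D c⁻¹`, `c = √μ`
  set c : ℝ := Real.sqrt μ with hc
  have hcpos : 0 < c := Real.sqrt_pos.2 hμ
  have hc0 : c ≠ 0 := hcpos.ne'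
  have hμc : μ = c ^ 2 := by rw [hc, Real.sq_sqrt hμ.le]
  set M : EuclideanSpace ℝ (Fin 3) →L[ℝ] EuclideanSpace ℝ (Fin 3) :=
    ContinuousLinearMap.id ℝ (EuclideanSpace ℝ (Fin 3)) +
      (c - 1) • (EuclideanSpace.proj (2 : Fin 3) : EuclideanSpace ℝ (Fin 3) →L[ℝ] ℝ).smulRight
        (EuclideanSpace.single (2 : Fin 3) (1 : ℝ)) with hM
  set N : EuclideanSpace ℝ (Fin 3) →L[ℝ] EuclideanSpace ℝ (Fin 3) :=
    ContinuousLinearMap.id ℝ (EuclideanSpace ℝ (Fin 3)) +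
      (c⁻¹ - 1) • (EuclideanSpace.proj (2 : Fin 3) : EuclideanSpace ℝ (Fin 3) →L[ℝ] ℝ).smulRight
        (EuclideanSpace.single (2 : Fin 3) (1 : ℝ)) with hN
  have hNM : ∀ w, N (M w) = w := fun w => by simpa [hM, hN] using rescale_inv_apply hc0 w
  -- every slice is constant
  have hconst : ∀ s < 0, ∀ x, v s x = v s 0 := by
    intro s hs x
    have hC2 : ContDiff ℝ 2 (v s) := (analyticOnNhd_slice hcont (bdd_of_hasTypeITimeDecay hrate) hmild hs).contDiff
    have hVd : Differentiable ℝ (v s) := hC2.differentiable (by simp)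
    -- the rescaled slice `ũ = M ∘ v(s) ∘ N`
    have hu2 : ContDiff ℝ 2 (fun y : EuclideanSpace ℝ (Fin 3) => M (v s (N y))) :=
      M.contDiff.comp (hC2.comp N.contDiff)
    have hucurl : ∀ y, curl (fun y : EuclideanSpace ℝ (Fin 3) => M (v s (N y))) y = 0 := by
      intro y
      have hp := hpol s hs (N y)
      rw [EuclideanSpace.inner_single_right, one_mul, conj_trivial, curl_apply_two_eq, sub_eq_zero] at hp
      simpa [hM, hN] using curl_rescale_eq_zero (V := v s) hc0 hμc y (hVd _) (by simpa [hN] using hp)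
        (by simpa [hN] using (hshear s hs (N y)).1) (by simpa [hN] using (hshear s hs (N y)).2)
    have hudiv : VectorCalculus.IsDivFree (fun y : EuclideanSpace ℝ (Fin 3) => M (v s (N y))) := by
      intro y
      simpa [hM, hN] using divergence_rescale_eq_zero (V := v s) hc0 y (hVd _) (hdiv s hs _)
    have hubdd : ∀ y, ‖M (v s (N y))‖ ≤ ‖M‖ * (C / Real.sqrt (-s)) := fun y =>
      (M.le_opNorm _).trans (mul_le_mul_of_nonneg_left (hrate s hs _) (norm_nonneg _))
    have hMeq : M (v s x) = M (v s 0) := by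
      have h := eq_of_curl_eq_zero_of_isDivFree_of_bounded hu2 hucurl hudiv hubdd (M x) 0
      simpa [hNM, map_zero] using h
    simpa [hNM] using congrArg N hMeq
  exact fun t ht x => hA.eq_zero_of_slice_const (b := fun t => v t 0) hconst ht x

/-- **The same stratum in Clebsch language.** If the horizontal gradient of the vertical velocity is a constant
multiple `λ ∉ [0,1]` of the rotated horizontal vorticity (`∂₀v₂ = −λ ω₁`, `∂₁v₂ = λ ω₀`, i.e. `∇_h v₂ = λ ∇_h ψ`
for every Clebsch stream function `ψ`: constant Clebsch slope), the profile vanishes: kinematically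
`∂₂v_h = (1 − 1/λ) ∇_h v₂` and `1 − 1/λ > 0`. -/
theorem eq_zero_of_clebschSlope_const {C : ℝ} {v : ℝ → EuclideanSpace ℝ (Fin 3) → EuclideanSpace ℝ (Fin 3)}
    (hrate : HasTypeITimeDecay C v)
    (hcont : ContinuousOn (uncurry v) (Iio (0 : ℝ) ×ˢ univ))
    (hmild : ∀ s t : ℝ, s < t → t < 0 → ∀ x,
      v t x = UnboundedOperators.heatExtension (v s) (t - s) x - oseenDuhamel 1 s v v t x)
    (hdiv : ∀ t < 0, VectorCalculus.IsDivFree (v t))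
    (hpol : ∀ s < 0, ∀ y, ⟪curl (v s) y, EuclideanSpace.single 2 1⟫_ℝ = 0)
    {lam : ℝ} (hlam : lam < 0 ∨ 1 < lam)
    (hslope : ∀ s < 0, ∀ y, fderiv ℝ (v s) y (EuclideanSpace.single 0 (1 : ℝ)) 2 = -(lam * curl (v s) y 1) ∧
      fderiv ℝ (v s) y (EuclideanSpace.single 1 (1 : ℝ)) 2 = lam * curl (v s) y 0) :
    ∀ t < 0, ∀ x, v t x = 0 := by
  have hlam0 : lam ≠ 0 := by rcases hlam with h | h <;> [exact h.ne; exact (zero_lt_one.trans h).ne']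
  have hμ : 0 < 1 - 1 / lam := by
    rcases hlam with h | h
    · have : 1 / lam < 0 := div_neg_of_pos_of_neg one_pos h
      linarith
    · have : 1 / lam < 1 := (div_lt_one (zero_lt_one.trans h)).2 h
      linarith
  refine eq_zero_of_proportionalShear hrate hcont hmild hdiv hpol hμ fun s hs y => ?_
  have hc0 : curl (v s) y 0 = fderiv ℝ (v s) y (EuclideanSpace.single 1 (1 : ℝ)) 2 -
      fderiv ℝ (v s) y (EuclideanSpace.single 2 (1 : ℝ)) 1 := by simp [curl]
  have hc1 : curl (v s) y 1 = fderiv ℝ (v s) y (EuclideanSpace.single 2 (1 : ℝ)) 0 -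
      fderiv ℝ (v s) y (EuclideanSpace.single 0 (1 : ℝ)) 2 := by simp [curl]
  obtain ⟨h0, h1⟩ := hslope s hs y
  rw [hc1] at h0
  rw [hc0] at h1
  constructor
  · field_simp
    have : lam * fderiv ℝ (v s) y (EuclideanSpace.single 2 (1 : ℝ)) 0 =
        (lam - 1) * fderiv ℝ (v s) y (EuclideanSpace.single 0 (1 : ℝ)) 2 := by linarith
    linarith
  · field_simp
    have : lam * fderiv ℝ (v s) y (EuclideanSpace.single 2 (1 : ℝ)) 1 =
        (lam - 1) * fderiv ℝ (v s) y (EuclideanSpace.single 1 (1 : ℝ)) 2 := by linarith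
    linarith

/-- **The proportional-shear stratum in the stub's currency**: such a profile is not backward-singular at the apex. -/
theorem nonflatLiouville_of_proportionalShear {C : ℝ} {v : ℝ → EuclideanSpace ℝ (Fin 3) → EuclideanSpace ℝ (Fin 3)}
    (hrate : HasTypeITimeDecay C v)
    (hcont : ContinuousOn (uncurry v) (Iio (0 : ℝ) ×ˢ univ))
    (hmild : ∀ s t : ℝ, s < t → t < 0 → ∀ x,
      v t x = UnboundedOperators.heatExtension (v s) (t - s) x - oseenDuhamel 1 s v v t x)
    (hdiv : ∀ t < 0, VectorCalculus.IsDivFree (v t))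
    (hpol : ∀ s < 0, ∀ y, ⟪curl (v s) y, EuclideanSpace.single 2 1⟫_ℝ = 0)
    {μ : ℝ} (hμ : 0 < μ)
    (hshear : ∀ s < 0, ∀ y, fderiv ℝ (v s) y (EuclideanSpace.single 2 (1 : ℝ)) 0 =
        μ * fderiv ℝ (v s) y (EuclideanSpace.single 0 (1 : ℝ)) 2 ∧
      fderiv ℝ (v s) y (EuclideanSpace.single 2 (1 : ℝ)) 1 =
        μ * fderiv ℝ (v s) y (EuclideanSpace.single 1 (1 : ℝ)) 2) :
    ¬ IsBackwardSingularPoint v 0 :=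
  not_backwardSingular_of_zero (eq_zero_of_proportionalShear hrate hcont hmild hdiv hpol hμ hshear)

end Summit.NavierStokesRegularity.NavierStokesRegularity.Theorems.PoloidalWindowDoorPoloidalWindowRigidityProportionalShear
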